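import Summits.Ventures.CertifiedManyBodySolver.Observables.StiffnessApexTransport
import HarnessLib

/-!
# Ventures/CertifiedManyBodySolver — Observables/StiffnessApexTransportLaBoxE.lean

HONEST FRAMING: one-sided certified CEILINGS on the uniform flux stiffness (t–t′ f-sum class) on the hubbard-obs M2(b) box «La214-E»
`t′/t ∈ [−3/10, −1/5] × U/t ∈ [29/5, 74/5] × n = 1`, CONDITIONAL on the source row families they name; a ceiling never speaks to the
presence of order; CONTROL/CALIBRATION words, never «certified true negative»; not a `T_c` estimate, not a superconductivity verdict.
Zero compute, no definition, no claim node, no `sorry`.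

Cell `pub/hubbard-downfold` (D-0150 L-DF2 «box ↦ one word»), seat `hubbard-downfold-unc-2` (`prover-hubbard-downfold-unc-2-g13-0`). The
«La214-E» instances of the APEX TRANSPORT box instrument (`Observables/StiffnessApexTransport.lean` §4): the `U`-interior of the box is
covered from source `t′`-segments at LOW-`U` stations, extended in `t′` beyond `−3/10` by the factor `2 − U_A/U_max`:

* ONE station `U_A = 29/5`: source segment `[−357/740, −1/5]` (`357/740 = (3/10)(119/74) ≈ 0.4824`) ⇒ the whole box
  (`ObsStiffnessSeqCeilingAt_on_laBoxE_of_forall_apexStation29o5_orbitLower`);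
* THREE stations `U_A ∈ {29/5, 8, 11}` (slabs `[29/5, 8]`, `[8, 11]`, `[11, 74/5]`): source segments `[−153/400, −1/5]`, `[−21/55, −1/5]`,
  `[−279/740, −1/5]` (overhang only to `≈ −0.383`) ⇒ the whole box (`…_of_three_apexStations_orbitLower`).
The source families are what shared-dual `t′`-segment certificates at the stations deliver (hubbard-algo (ii-b) «dual replay»,
`StiffnessTPrimeSegmentLeaf` / `…ConvexCombObjective`); the box word is the worst source word; the overhang beyond `−3/10` is the price
[EST ≤ 0.01–0.02 on the f-sum word at `U = 29/5`; an expectation, not a certified number]. Single corner rows already word their apex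
curves (`ObsStiffnessSeqCeilingAt_halfFilling_on_apexCurve_of_fsumRow`): the `(29/5, 1, −3/10)` word holds at `(8, 1, −4/17)`, `(10, 1, −15/71)`,
`(58/5, 1, −1/5)`; the `(6, 1, −3/10)` calibration word at `(8, 1, −6/25)`, `(9, 1, −9/40)`, `(12, 1, −1/5)`.

References: T. Koma, H. Tasaki, J. Stat. Phys. 76 (1994) 745, §1 [KomaTasaki1994]; D. J. Scalapino, S. R. White, S.-C. Zhang, PRB 47 (1993)
7995, §II [ScalapinoWhiteZhang1993].
-/

noncomputable section

namespace Summit.Ventures.CertifiedManyBodySolver.Observables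

open Literature.MathematicalPhysics.QuantumLattice
open Literature.MathematicalPhysics.QuantumLattice.ThermodynamicLimit
open Literature.MathematicalPhysics.QuantumFieldTheory
open Literature.Probability.LatticeModels
open Matrix Finset Filter Topology HubbardWave0
open scoped Matrix BigOperators ComplexOrder

/-! ## §5 «La214-E» `[−3/10, −1/5] × [29/5, 74/5]` at `n = 1`: one station, or three -/

section LaBoxE

/-- The single-station source segment of «La214-E»: `(−3/10)·(2 − (29/5)/(74/5)) = −357/740` (`= −(3/10)(119/74) ≈ −0.48243`). [folklore] -/
theorem laBoxE_apexStation29o5_overhang : (-3 / 10 : ℝ) * (2 - 29 / 5 / (74 / 5)) = -(357 / 740) := by norm_num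

/-- **«La214-E» FROM ONE STATION.** An unconditional orbit-lower family `val` for the f-sum word on the source segment
`s ∈ [−357/740, −1/5]` at the station `U_A = 29/5` (half filling), with `−val s ≤ c` there, gives `ObsStiffnessSeqCeilingAt t′ U 1 c` for EVERY
`(t′, U) ∈ [−3/10, −1/5] × [29/5, 74/5]` — corners, edges AND interior. The box word is the worst source word; the overhang `[−0.4824, −3/10)` is
the price of covering the high-`U` × large-`|t′|` corner from the low-`U` edge. [cite: KomaTasaki1994, §1] [cite: ScalapinoWhiteZhang1993, §II] -/
theorem ObsStiffnessSeqCeilingAt_on_laBoxE_of_forall_apexStation29o5_orbitLower (val : ℝ → ℝ) (c : ℚ)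
    (h : ∀ s ∈ Set.Icc (-(357 / 740) : ℝ) (-1 / 5),
      ∀ (ω : InfVolFermionState 2) (Ls : ℕ → ℕ) (ψ : ∀ L, Fock (Orb (FermionTorus 2 L))),
      Tendsto Ls atTop atTop →
      (∀ j, IsGroundStateInSector (hubbardTorusTT' (Ls j) 1 s (29 / 5)) (rectN 1 (Ls j)) 0 (ψ (Ls j))) →
      (∀ j, star (ψ (Ls j)) ⬝ᵥ ψ (Ls j) = 1) → ω.IsTorusLimitOf ψ Ls →
      val s ≤ ((Finset.univ : Finset (DihedralGroup 4)).card : ℝ)⁻¹ * ∑ g ∈ (Finset.univ : Finset (DihedralGroup 4)),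
        (ω.expect (d4ShiftSet g 0 (box 2 7)) (fermionEmbed (PolySite.d4Emb g 0 (box 2 7)) (-oddMomentObsTT s (29 / 5) 0))).re)
    (hc : ∀ s ∈ Set.Icc (-(357 / 740) : ℝ) (-1 / 5), -val s ≤ ((c : ℚ) : ℝ)) :
    ∀ tp ∈ Set.Icc (-3 / 10 : ℝ) (-1 / 5), ∀ U ∈ Set.Icc (29 / 5 : ℝ) (74 / 5), ObsStiffnessSeqCeilingAt tp U 1 c := by
  intro tp htp U hU
  have hmem := apexSource_mem_Icc_of_slab (Umax := 74 / 5) (p := -3 / 10) (q := -1 / 5)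
    (by norm_num : (0 : ℝ) < 29 / 5) hU.1 hU.2 (by norm_num) htp
  rw [laBoxE_apexStation29o5_overhang] at hmem
  exact ObsStiffnessSeqCeilingAt_halfFilling_of_forall_apexStation_orbitLower (by norm_num) val c h hc hU.1
    (by linarith [hU.1]) hmem

/-- The three-station overhangs of «La214-E» (slabs `[29/5, 8]`, `[8, 11]`, `[11, 74/5]`):
`(−3/10)(2 − (29/5)/8) = −153/400`, `(−3/10)(2 − 8/11) = −21/55`, `(−3/10)(2 − 11/(74/5)) = −279/740` (`≈ −0.3825, −0.3818, −0.3770`). [folklore] -/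
theorem laBoxE_three_apexStations_overhangs :
    (-3 / 10 : ℝ) * (2 - 29 / 5 / 8) = -(153 / 400) ∧ (-3 / 10 : ℝ) * (2 - 8 / 11) = -(21 / 55) ∧
      (-3 / 10 : ℝ) * (2 - 11 / (74 / 5)) = -(279 / 740) := by
  refine ⟨?_, ?_, ?_⟩ <;> norm_num

/-- **«La214-E» FROM THREE STATIONS** `U_A ∈ {29/5, 8, 11}` with source segments `[−153/400, −1/5]`, `[−21/55, −1/5]`, `[−279/740, −1/5]`
(overhang only to `t′ ≈ −0.383`): three unconditional orbit-lower families (half filling), each with `−valᵢ ≤ c` on its segment, give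
`ObsStiffnessSeqCeilingAt t′ U 1 c` on the whole box `[−3/10, −1/5] × [29/5, 74/5]`. [cite: KomaTasaki1994, §1] [cite: ScalapinoWhiteZhang1993, §II] -/
theorem ObsStiffnessSeqCeilingAt_on_laBoxE_of_three_apexStations_orbitLower (val₁ val₂ val₃ : ℝ → ℝ) (c : ℚ)
    (h₁ : ∀ s ∈ Set.Icc (-(153 / 400) : ℝ) (-1 / 5),
      ∀ (ω : InfVolFermionState 2) (Ls : ℕ → ℕ) (ψ : ∀ L, Fock (Orb (FermionTorus 2 L))),
      Tendsto Ls atTop atTop →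
      (∀ j, IsGroundStateInSector (hubbardTorusTT' (Ls j) 1 s (29 / 5)) (rectN 1 (Ls j)) 0 (ψ (Ls j))) →
      (∀ j, star (ψ (Ls j)) ⬝ᵥ ψ (Ls j) = 1) → ω.IsTorusLimitOf ψ Ls →
      val₁ s ≤ ((Finset.univ : Finset (DihedralGroup 4)).card : ℝ)⁻¹ * ∑ g ∈ (Finset.univ : Finset (DihedralGroup 4)),
        (ω.expect (d4ShiftSet g 0 (box 2 7)) (fermionEmbed (PolySite.d4Emb g 0 (box 2 7)) (-oddMomentObsTT s (29 / 5) 0))).re)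
    (hc₁ : ∀ s ∈ Set.Icc (-(153 / 400) : ℝ) (-1 / 5), -val₁ s ≤ ((c : ℚ) : ℝ))
    (h₂ : ∀ s ∈ Set.Icc (-(21 / 55) : ℝ) (-1 / 5),
      ∀ (ω : InfVolFermionState 2) (Ls : ℕ → ℕ) (ψ : ∀ L, Fock (Orb (FermionTorus 2 L))),
      Tendsto Ls atTop atTop →
      (∀ j, IsGroundStateInSector (hubbardTorusTT' (Ls j) 1 s 8) (rectN 1 (Ls j)) 0 (ψ (Ls j))) →
      (∀ j, star (ψ (Ls j)) ⬝ᵥ ψ (Ls j) = 1) → ω.IsTorusLimitOf ψ Ls →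
      val₂ s ≤ ((Finset.univ : Finset (DihedralGroup 4)).card : ℝ)⁻¹ * ∑ g ∈ (Finset.univ : Finset (DihedralGroup 4)),
        (ω.expect (d4ShiftSet g 0 (box 2 7)) (fermionEmbed (PolySite.d4Emb g 0 (box 2 7)) (-oddMomentObsTT s 8 0))).re)
    (hc₂ : ∀ s ∈ Set.Icc (-(21 / 55) : ℝ) (-1 / 5), -val₂ s ≤ ((c : ℚ) : ℝ))
    (h₃ : ∀ s ∈ Set.Icc (-(279 / 740) : ℝ) (-1 / 5),
      ∀ (ω : InfVolFermionState 2) (Ls : ℕ → ℕ) (ψ : ∀ L, Fock (Orb (FermionTorus 2 L))),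
      Tendsto Ls atTop atTop →
      (∀ j, IsGroundStateInSector (hubbardTorusTT' (Ls j) 1 s 11) (rectN 1 (Ls j)) 0 (ψ (Ls j))) →
      (∀ j, star (ψ (Ls j)) ⬝ᵥ ψ (Ls j) = 1) → ω.IsTorusLimitOf ψ Ls →
      val₃ s ≤ ((Finset.univ : Finset (DihedralGroup 4)).card : ℝ)⁻¹ * ∑ g ∈ (Finset.univ : Finset (DihedralGroup 4)),
        (ω.expect (d4ShiftSet g 0 (box 2 7)) (fermionEmbed (PolySite.d4Emb g 0 (box 2 7)) (-oddMomentObsTT s 11 0))).re)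
    (hc₃ : ∀ s ∈ Set.Icc (-(279 / 740) : ℝ) (-1 / 5), -val₃ s ≤ ((c : ℚ) : ℝ)) :
    ∀ tp ∈ Set.Icc (-3 / 10 : ℝ) (-1 / 5), ∀ U ∈ Set.Icc (29 / 5 : ℝ) (74 / 5), ObsStiffnessSeqCeilingAt tp U 1 c := by
  obtain ⟨e₁, e₂, e₃⟩ := laBoxE_three_apexStations_overhangs
  intro tp htp U hU
  rcases le_total U 8 with hU8 | hU8
  · have hmem := apexSource_mem_Icc_of_slab (Umax := 8) (p := -3 / 10) (q := -1 / 5) (by norm_num : (0 : ℝ) < 29 / 5) hU.1 hU8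
      (by norm_num) htp
    rw [e₁] at hmem
    exact ObsStiffnessSeqCeilingAt_halfFilling_of_forall_apexStation_orbitLower (by norm_num) val₁ c h₁ hc₁ hU.1
      (by linarith [hU.1]) hmem
  rcases le_total U 11 with hU11 | hU11
  · have hmem := apexSource_mem_Icc_of_slab (Umax := 11) (p := -3 / 10) (q := -1 / 5) (by norm_num : (0 : ℝ) < 8) hU8 hU11
      (by norm_num) htp
    rw [e₂] at hmem
    exact ObsStiffnessSeqCeilingAt_halfFilling_of_forall_apexStation_orbitLower (by norm_num) val₂ c h₂ hc₂ hU8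
      (by linarith) hmem
  · have hmem := apexSource_mem_Icc_of_slab (Umax := 74 / 5) (p := -3 / 10) (q := -1 / 5) (by norm_num : (0 : ℝ) < 11) hU11
      hU.2 (by norm_num) htp
    rw [e₃] at hmem
    exact ObsStiffnessSeqCeilingAt_halfFilling_of_forall_apexStation_orbitLower (by norm_num) val₃ c h₃ hc₃ hU11
      (by linarith) hmem

end LaBoxE

/-- The «La214-E» calibration corner `(6, 1, −3/10)`: its apex curve passes `(8, −6/25)`, `(9, −9/40)`, `(12, −1/5)`:
`(−3/10)·8/(16 − 6) = −6/25`, `(−3/10)·9/(18 − 6) = −9/40`, `(−3/10)·12/(24 − 6) = −1/5`. [folklore] -/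
theorem laBoxE_corner6_apexCurve_points :
    (-3 / 10 : ℝ) * 8 / (2 * 8 - 6) = -6 / 25 ∧ (-3 / 10 : ℝ) * 9 / (2 * 9 - 6) = -9 / 40 ∧
      (-3 / 10 : ℝ) * 12 / (2 * 12 - 6) = -1 / 5 := by
  refine ⟨?_, ?_, ?_⟩ <;> norm_num

/-! ## Two sub-segment bundles at ONE station (hubbard-obs RULING (fff) d302 (fff2): the extended edge `[a, q] = [a, m] ∪ [m, q]`,
one shared-dual («boxdual») bundle per sub-segment; append, same seat) -/

section TwoChords

variable {UA Umax p q m : ℝ}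

/-- **THE BOX FROM ONE STATION WITH TWO CHORD BUNDLES (half filling).** Station `U_A > 0`, targets `[p, q] × [U_A, U_max]`, `q ≤ 0`; the source
segment `[p(2 − U_A/U_max), q]` split at `m`. If on the OUTER sub-segment `[p(2 − U_A/U_max), m]` the orbit-lower family is the chord of the corner
constants `v₁` (outer corner) and `v₂` (at `m`), and on the INNER sub-segment `[m, q]` the chord of `v₃` (at `m`) and `v₄` (at `q`) — the shapes two
boxdual bundles deliver through `…_convexCombObj_TT'_ineq_affine` — then `ObsStiffnessSeqCeilingAt tp U 1 c` on the whole box for every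
`c ≥ max(−v₁, −v₂, −v₃, −v₄)`: the box word is the worst of the four corner words. [cite: KomaTasaki1994, §1] [cite: ScalapinoWhiteZhang1993, §II] -/
theorem ObsStiffnessSeqCeilingAt_halfFilling_on_box_of_apexStation_two_chords (hUA : 0 < UA) (hq : q ≤ 0)
    (ham : p * (2 - UA / Umax) < m) (hmq : m < q) (v₁ v₂ v₃ v₄ : ℝ) (c : ℚ) (hc₁ : -v₁ ≤ ((c : ℚ) : ℝ))
    (hc₂ : -v₂ ≤ ((c : ℚ) : ℝ)) (hc₃ : -v₃ ≤ ((c : ℚ) : ℝ)) (hc₄ : -v₄ ≤ ((c : ℚ) : ℝ))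
    (hL : ∀ s ∈ Set.Icc (p * (2 - UA / Umax)) m,
      ∀ (ω : InfVolFermionState 2) (Ls : ℕ → ℕ) (ψ : ∀ L, Fock (Orb (FermionTorus 2 L))),
      Tendsto Ls atTop atTop →
      (∀ j, IsGroundStateInSector (hubbardTorusTT' (Ls j) 1 s UA) (rectN 1 (Ls j)) 0 (ψ (Ls j))) →
      (∀ j, star (ψ (Ls j)) ⬝ᵥ ψ (Ls j) = 1) → ω.IsTorusLimitOf ψ Ls →
      (m - s) / (m - p * (2 - UA / Umax)) * v₁ + (s - p * (2 - UA / Umax)) / (m - p * (2 - UA / Umax)) * v₂ ≤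
        ((Finset.univ : Finset (DihedralGroup 4)).card : ℝ)⁻¹ * ∑ g ∈ (Finset.univ : Finset (DihedralGroup 4)),
          (ω.expect (d4ShiftSet g 0 (box 2 7)) (fermionEmbed (PolySite.d4Emb g 0 (box 2 7)) (-oddMomentObsTT s UA 0))).re)
    (hR : ∀ s ∈ Set.Icc m q,
      ∀ (ω : InfVolFermionState 2) (Ls : ℕ → ℕ) (ψ : ∀ L, Fock (Orb (FermionTorus 2 L))),
      Tendsto Ls atTop atTop →
      (∀ j, IsGroundStateInSector (hubbardTorusTT' (Ls j) 1 s UA) (rectN 1 (Ls j)) 0 (ψ (Ls j))) →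
      (∀ j, star (ψ (Ls j)) ⬝ᵥ ψ (Ls j) = 1) → ω.IsTorusLimitOf ψ Ls →
      (q - s) / (q - m) * v₃ + (s - m) / (q - m) * v₄ ≤
        ((Finset.univ : Finset (DihedralGroup 4)).card : ℝ)⁻¹ * ∑ g ∈ (Finset.univ : Finset (DihedralGroup 4)),
          (ω.expect (d4ShiftSet g 0 (box 2 7)) (fermionEmbed (PolySite.d4Emb g 0 (box 2 7)) (-oddMomentObsTT s UA 0))).re) :
    ∀ tp ∈ Set.Icc p q, ∀ U ∈ Set.Icc UA Umax, ObsStiffnessSeqCeilingAt tp U 1 c := by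
  classical
  refine ObsStiffnessSeqCeilingAt_halfFilling_on_box_of_forall_apexStation_orbitLower hUA hq
    (fun s => if s ≤ m then (m - s) / (m - p * (2 - UA / Umax)) * v₁ + (s - p * (2 - UA / Umax)) / (m - p * (2 - UA / Umax)) * v₂
      else (q - s) / (q - m) * v₃ + (s - m) / (q - m) * v₄) c ?_ ?_
  · intro s hs ω Ls ψ hLs hψ h1 hω
    by_cases hsm : s ≤ m
    · rw [if_pos hsm]; exact hL s ⟨hs.1, hsm⟩ ω Ls ψ hLs hψ h1 hω
    · rw [if_neg hsm]; exact hR s ⟨(not_le.1 hsm).le, hs.2⟩ ω Ls ψ hLs hψ h1 hω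
  · intro s hs
    by_cases hsm : s ≤ m
    · rw [if_pos hsm]
      obtain ⟨hl₁, hl₂, hsum, -, -⟩ := tPrimeSegment_weights ham hs.1 hsm
      have hmin := min_le_chord_of_weights (c₁ := v₁) (c₂ := v₂) hl₁ hl₂ hsum
      have hneg : -min v₁ v₂ ≤ ((c : ℚ) : ℝ) := by
        rcases le_total v₁ v₂ with hv | hv
        · rw [min_eq_left hv]; exact hc₁
        · rw [min_eq_right hv]; exact hc₂
      linarith
    · rw [if_neg hsm]
      obtain ⟨hl₁, hl₂, hsum, -, -⟩ := tPrimeSegment_weights hmq (not_le.1 hsm).le hs.2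
      have hmin := min_le_chord_of_weights (c₁ := v₃) (c₂ := v₄) hl₁ hl₂ hsum
      have hneg : -min v₃ v₄ ≤ ((c : ℚ) : ℝ) := by
        rcases le_total v₃ v₄ with hv | hv
        · rw [min_eq_left hv]; exact hc₃
        · rw [min_eq_right hv]; exact hc₄
      linarith

/-- **«La214-E» FROM THE TWO BUNDLES OF RULING (fff) d302** — outer bundle «29/5-overhang» on `[−357/740, −3/10]` (corner words `v₁` at
`s = −357/740`, `v₂` at `−3/10`) and inner bundle «29/5-inner» on `[−3/10, −1/5]` (`v₃` at `−3/10`, `v₄` at `−1/5`), both at the station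
`U = 29/5`, `n = 1`, each delivering the chord family: `ObsStiffnessSeqCeilingAt t′ U 1 c` on ALL of `[−3/10, −1/5] × [29/5, 74/5]` for every
`c ≥ max(−v₁, −v₂, −v₃, −v₄)` — the pen's «c_box = max over the two bundles' floors». [cite: KomaTasaki1994, §1] [cite: ScalapinoWhiteZhang1993, §II] -/
theorem ObsStiffnessSeqCeilingAt_on_laBoxE_of_apexStation29o5_two_chords (v₁ v₂ v₃ v₄ : ℝ) (c : ℚ)
    (hc₁ : -v₁ ≤ ((c : ℚ) : ℝ)) (hc₂ : -v₂ ≤ ((c : ℚ) : ℝ)) (hc₃ : -v₃ ≤ ((c : ℚ) : ℝ)) (hc₄ : -v₄ ≤ ((c : ℚ) : ℝ))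
    (hOuter : ∀ s ∈ Set.Icc (-(357 / 740) : ℝ) (-3 / 10),
      ∀ (ω : InfVolFermionState 2) (Ls : ℕ → ℕ) (ψ : ∀ L, Fock (Orb (FermionTorus 2 L))),
      Tendsto Ls atTop atTop →
      (∀ j, IsGroundStateInSector (hubbardTorusTT' (Ls j) 1 s (29 / 5)) (rectN 1 (Ls j)) 0 (ψ (Ls j))) →
      (∀ j, star (ψ (Ls j)) ⬝ᵥ ψ (Ls j) = 1) → ω.IsTorusLimitOf ψ Ls →
      (-3 / 10 - s) / (-3 / 10 - -(357 / 740)) * v₁ + (s - -(357 / 740)) / (-3 / 10 - -(357 / 740)) * v₂ ≤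
        ((Finset.univ : Finset (DihedralGroup 4)).card : ℝ)⁻¹ * ∑ g ∈ (Finset.univ : Finset (DihedralGroup 4)),
          (ω.expect (d4ShiftSet g 0 (box 2 7)) (fermionEmbed (PolySite.d4Emb g 0 (box 2 7)) (-oddMomentObsTT s (29 / 5) 0))).re)
    (hInner : ∀ s ∈ Set.Icc (-3 / 10 : ℝ) (-1 / 5),
      ∀ (ω : InfVolFermionState 2) (Ls : ℕ → ℕ) (ψ : ∀ L, Fock (Orb (FermionTorus 2 L))),
      Tendsto Ls atTop atTop →
      (∀ j, IsGroundStateInSector (hubbardTorusTT' (Ls j) 1 s (29 / 5)) (rectN 1 (Ls j)) 0 (ψ (Ls j))) →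
      (∀ j, star (ψ (Ls j)) ⬝ᵥ ψ (Ls j) = 1) → ω.IsTorusLimitOf ψ Ls →
      (-1 / 5 - s) / (-1 / 5 - -3 / 10) * v₃ + (s - -3 / 10) / (-1 / 5 - -3 / 10) * v₄ ≤
        ((Finset.univ : Finset (DihedralGroup 4)).card : ℝ)⁻¹ * ∑ g ∈ (Finset.univ : Finset (DihedralGroup 4)),
          (ω.expect (d4ShiftSet g 0 (box 2 7)) (fermionEmbed (PolySite.d4Emb g 0 (box 2 7)) (-oddMomentObsTT s (29 / 5) 0))).re) :
    ∀ tp ∈ Set.Icc (-3 / 10 : ℝ) (-1 / 5), ∀ U ∈ Set.Icc (29 / 5 : ℝ) (74 / 5), ObsStiffnessSeqCeilingAt tp U 1 c := by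
  have e := laBoxE_apexStation29o5_overhang
  refine ObsStiffnessSeqCeilingAt_halfFilling_on_box_of_apexStation_two_chords (Umax := 74 / 5) (p := -3 / 10) (q := -1 / 5)
    (m := -3 / 10) (by norm_num) (by norm_num) (by rw [e]; norm_num) (by norm_num) v₁ v₂ v₃ v₄ c hc₁ hc₂ hc₃ hc₄ ?_ hInner
  rw [e]
  exact hOuter

end TwoChords

/-! ## §6 (append, seat g14) FOUR stations `29/5, 13/2, 8, 11`: the finer bottom ladder (overhang at the binding `U = 29/5` only to `−108/325 ≈ −0.332`) -/

section FourStations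

/-- The four-station overhangs of «La214-E» (slabs `[29/5, 13/2]`, `[13/2, 8]`, `[8, 11]`, `[11, 74/5]`):
`(−3/10)(2 − (29/5)/(13/2)) = −108/325`, `(−3/10)(2 − (13/2)/8) = −57/160`, `(−3/10)(2 − 8/11) = −21/55`, `(−3/10)(2 − 11/(74/5)) = −279/740`
(`≈ −0.3323, −0.3563, −0.3818, −0.3770`). [folklore] -/
theorem laBoxE_four_apexStations_overhangs :
    (-3 / 10 : ℝ) * (2 - 29 / 5 / (13 / 2)) = -(108 / 325) ∧ (-3 / 10 : ℝ) * (2 - 13 / 2 / 8) = -(57 / 160) ∧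
      (-3 / 10 : ℝ) * (2 - 8 / 11) = -(21 / 55) ∧ (-3 / 10 : ℝ) * (2 - 11 / (74 / 5)) = -(279 / 740) := by
  refine ⟨?_, ?_, ?_, ?_⟩ <;> norm_num

/-- **«La214-E» FROM FOUR STATIONS** `U_A ∈ {29/5, 13/2, 8, 11}` with source segments `[−108/325, −1/5]`, `[−57/160, −1/5]`, `[−21/55, −1/5]`,
`[−279/740, −1/5]` (half filling): four unconditional f-sum orbit-lower families, each with `−valᵢ ≤ c` on its segment, give
`ObsStiffnessSeqCeilingAt t′ U 1 c` on the whole box `[−3/10, −1/5] × [29/5, 74/5]`. The extra station `13/2` shortens the overhang at the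
binding (weakest-Mott) station `29/5` from `−153/400` (three stations) to `−108/325`: the planning price of the bottom slab drops accordingly
(seat file `LA214E-STATION-LADDER.md`: required reduction below the local kinematic `4.8 % → 2.1 %` [float]). [cite: KomaTasaki1994, §1] [cite: ScalapinoWhiteZhang1993, §II] -/
theorem ObsStiffnessSeqCeilingAt_on_laBoxE_of_four_apexStations_orbitLower (val₁ val₂ val₃ val₄ : ℝ → ℝ) (c : ℚ)
    (h₁ : ∀ s ∈ Set.Icc (-(108 / 325) : ℝ) (-1 / 5),
      ∀ (ω : InfVolFermionState 2) (Ls : ℕ → ℕ) (ψ : ∀ L, Fock (Orb (FermionTorus 2 L))),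
      Tendsto Ls atTop atTop →
      (∀ j, IsGroundStateInSector (hubbardTorusTT' (Ls j) 1 s (29 / 5)) (rectN 1 (Ls j)) 0 (ψ (Ls j))) →
      (∀ j, star (ψ (Ls j)) ⬝ᵥ ψ (Ls j) = 1) → ω.IsTorusLimitOf ψ Ls →
      val₁ s ≤ ((Finset.univ : Finset (DihedralGroup 4)).card : ℝ)⁻¹ * ∑ g ∈ (Finset.univ : Finset (DihedralGroup 4)),
        (ω.expect (d4ShiftSet g 0 (box 2 7)) (fermionEmbed (PolySite.d4Emb g 0 (box 2 7)) (-oddMomentObsTT s (29 / 5) 0))).re)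
    (hc₁ : ∀ s ∈ Set.Icc (-(108 / 325) : ℝ) (-1 / 5), -val₁ s ≤ ((c : ℚ) : ℝ))
    (h₂ : ∀ s ∈ Set.Icc (-(57 / 160) : ℝ) (-1 / 5),
      ∀ (ω : InfVolFermionState 2) (Ls : ℕ → ℕ) (ψ : ∀ L, Fock (Orb (FermionTorus 2 L))),
      Tendsto Ls atTop atTop →
      (∀ j, IsGroundStateInSector (hubbardTorusTT' (Ls j) 1 s (13 / 2)) (rectN 1 (Ls j)) 0 (ψ (Ls j))) →
      (∀ j, star (ψ (Ls j)) ⬝ᵥ ψ (Ls j) = 1) → ω.IsTorusLimitOf ψ Ls →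
      val₂ s ≤ ((Finset.univ : Finset (DihedralGroup 4)).card : ℝ)⁻¹ * ∑ g ∈ (Finset.univ : Finset (DihedralGroup 4)),
        (ω.expect (d4ShiftSet g 0 (box 2 7)) (fermionEmbed (PolySite.d4Emb g 0 (box 2 7)) (-oddMomentObsTT s (13 / 2) 0))).re)
    (hc₂ : ∀ s ∈ Set.Icc (-(57 / 160) : ℝ) (-1 / 5), -val₂ s ≤ ((c : ℚ) : ℝ))
    (h₃ : ∀ s ∈ Set.Icc (-(21 / 55) : ℝ) (-1 / 5),
      ∀ (ω : InfVolFermionState 2) (Ls : ℕ → ℕ) (ψ : ∀ L, Fock (Orb (FermionTorus 2 L))),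
      Tendsto Ls atTop atTop →
      (∀ j, IsGroundStateInSector (hubbardTorusTT' (Ls j) 1 s 8) (rectN 1 (Ls j)) 0 (ψ (Ls j))) →
      (∀ j, star (ψ (Ls j)) ⬝ᵥ ψ (Ls j) = 1) → ω.IsTorusLimitOf ψ Ls →
      val₃ s ≤ ((Finset.univ : Finset (DihedralGroup 4)).card : ℝ)⁻¹ * ∑ g ∈ (Finset.univ : Finset (DihedralGroup 4)),
        (ω.expect (d4ShiftSet g 0 (box 2 7)) (fermionEmbed (PolySite.d4Emb g 0 (box 2 7)) (-oddMomentObsTT s 8 0))).re)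
    (hc₃ : ∀ s ∈ Set.Icc (-(21 / 55) : ℝ) (-1 / 5), -val₃ s ≤ ((c : ℚ) : ℝ))
    (h₄ : ∀ s ∈ Set.Icc (-(279 / 740) : ℝ) (-1 / 5),
      ∀ (ω : InfVolFermionState 2) (Ls : ℕ → ℕ) (ψ : ∀ L, Fock (Orb (FermionTorus 2 L))),
      Tendsto Ls atTop atTop →
      (∀ j, IsGroundStateInSector (hubbardTorusTT' (Ls j) 1 s 11) (rectN 1 (Ls j)) 0 (ψ (Ls j))) →
      (∀ j, star (ψ (Ls j)) ⬝ᵥ ψ (Ls j) = 1) → ω.IsTorusLimitOf ψ Ls →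
      val₄ s ≤ ((Finset.univ : Finset (DihedralGroup 4)).card : ℝ)⁻¹ * ∑ g ∈ (Finset.univ : Finset (DihedralGroup 4)),
        (ω.expect (d4ShiftSet g 0 (box 2 7)) (fermionEmbed (PolySite.d4Emb g 0 (box 2 7)) (-oddMomentObsTT s 11 0))).re)
    (hc₄ : ∀ s ∈ Set.Icc (-(279 / 740) : ℝ) (-1 / 5), -val₄ s ≤ ((c : ℚ) : ℝ)) :
    ∀ tp ∈ Set.Icc (-3 / 10 : ℝ) (-1 / 5), ∀ U ∈ Set.Icc (29 / 5 : ℝ) (74 / 5), ObsStiffnessSeqCeilingAt tp U 1 c := by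
  obtain ⟨e₁, e₂, e₃, e₄⟩ := laBoxE_four_apexStations_overhangs
  intro tp htp U hU
  rcases le_total U (13 / 2) with hU65 | hU65
  · have hmem := apexSource_mem_Icc_of_slab (Umax := 13 / 2) (p := -3 / 10) (q := -1 / 5) (by norm_num : (0 : ℝ) < 29 / 5) hU.1 hU65
      (by norm_num) htp
    rw [e₁] at hmem
    exact ObsStiffnessSeqCeilingAt_halfFilling_of_forall_apexStation_orbitLower (by norm_num) val₁ c h₁ hc₁ hU.1
      (by linarith [hU.1]) hmem
  rcases le_total U 8 with hU8 | hU8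
  · have hmem := apexSource_mem_Icc_of_slab (Umax := 8) (p := -3 / 10) (q := -1 / 5) (by norm_num : (0 : ℝ) < 13 / 2) hU65 hU8
      (by norm_num) htp
    rw [e₂] at hmem
    exact ObsStiffnessSeqCeilingAt_halfFilling_of_forall_apexStation_orbitLower (by norm_num) val₂ c h₂ hc₂ hU65
      (by linarith) hmem
  rcases le_total U 11 with hU11 | hU11
  · have hmem := apexSource_mem_Icc_of_slab (Umax := 11) (p := -3 / 10) (q := -1 / 5) (by norm_num : (0 : ℝ) < 8) hU8 hU11
      (by norm_num) htp
    rw [e₃] at hmem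
    exact ObsStiffnessSeqCeilingAt_halfFilling_of_forall_apexStation_orbitLower (by norm_num) val₃ c h₃ hc₃ hU8
      (by linarith) hmem
  · have hmem := apexSource_mem_Icc_of_slab (Umax := 74 / 5) (p := -3 / 10) (q := -1 / 5) (by norm_num : (0 : ℝ) < 11) hU11
      hU.2 (by norm_num) htp
    rw [e₄] at hmem
    exact ObsStiffnessSeqCeilingAt_halfFilling_of_forall_apexStation_orbitLower (by norm_num) val₄ c h₄ hc₄ hU11
      (by linarith) hmem

end FourStations

end Summit.Ventures.CertifiedManyBodySolver.Observables

end
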